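import Summits.ValiantsHypothesis.ValiantsHypothesis.Theorems.LacunarySymmetroidMatrixDescartesPivotRankOneCriticalWindowsThreeQuintic

/-!
# `MatrixDescartes` census — rank-one `(2,3)₁`: THE LONE-LETTER LAW, part 3 (one sign change of the logarithmic derivative per window)

HONEST FRAMING.  Object-search cell `pub-symmetroid`, seat `val-sym-mdr-p1` (generation 22); helper file `--supports` the crux item
stmt-ValiantsHypothesis-18050 (`Theses.LacunarySymmetroid.MatrixDescartes`, OPEN, on HOLD) with NO closure claim.  Concludes the three-part
argument begun in `…CriticalWindowsThreeFence` (fence lemma, brackets) and `…CriticalWindowsThreeQuintic` (the quintic `𝒩`, its fence values);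
notation as there.  The `(2,3)₁` COUNT (`Z₊ ≤ 5`) is already in the kernel (`…PivotRankOneThree`); this file proves the MECHANISM the lineage located
(memo PROFILE-GAUGE.md §4–§5, 2 000/2 000 and the tight corner `bⱼ → a⁻, bᵢ → 0⁺`): the «K = 3 lone-letter law», with no slack argument.  Nothing here bears
on `MatrixDescartes` in its window, on `DoorA26` / `DoorA34`, registers / credences, or `VP ≠ VNP`; for `K ≥ 4` the weights do not eliminate and no
analogue is claimed.

THE POINT (def-free).  **`logDeriv_fence`** — for all `a, bᵢ, bⱼ > 0` and `0 < tᵢ < t₀ < tⱼ` (pivot letter at `t₀`, one upper letter alone on each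
side), with `Tₘ ∈ (t₀,tⱼ)` the positive root of `Qᵢ` (edge of the right window) and `r₊ ∈ (tᵢ,t₀)` the positive root of `Qⱼ` (edge of the left window):
the logarithmic derivative `ℓ` of the weight-free function `X₀^{bᵢ−bⱼ}Xᵢ^{a+bⱼ}Xⱼ^{−(a+bᵢ)}` is `> 0` on `(Tₘ, T_R)`, `= 0` at `T_R`, `< 0` on `(T_R, tⱼ)`,
and `< 0` on `(tᵢ, T_L)`, `= 0` at `T_L`, `> 0` on `(T_L, r₊)`, for unique `T_R`, `T_L`.  PROOF: `ℓ·Q₀QᵢQⱼ·∏(T−tₘ) = 2T·𝒩(T)`; the fence values give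
four real roots `ρ₁ < tᵢ < T_L < r₊ < ρ₃ < Tₘ < T_R < tⱼ` of the quintic; three of them lie outside each window and `𝒩` changes sign across it, so by
`fence` the window root is unique; the denominator has one sign per window.  CONSEQUENCE (analytic packaging in a sequel): the weight-free function is
strictly unimodal on each window, each level is taken at most twice per window, hence for EVERY weight vector the three-letter window profile has at
most two critical directions on each side of the pivot letter — at most one local maximum of the ψ-profile per side (memo §5's per-side law at `K = 3`).
[folklore] Intermediate value theorem, the fence lemma, sign bookkeeping.  No definitions, no named facts.
-/

-- `Summit.ValiantsHypothesis.ValiantsHypothesis.…` repeats a component by the D-0017 layout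
-- (single-conjunct summit), which the `dupNamespace` linter flags; the name is mandated.
set_option linter.dupNamespace false

open Polynomial

namespace Summit.ValiantsHypothesis.ValiantsHypothesis.Theorems.LacunarySymmetroidMatrixDescartes.Pivot.CriticalWindows.Three

/-! ## 5. THE LONE-LETTER LAW (derivative form): one sign change of `ℓ` per window -/

set_option maxHeartbeats 400000 in
-- one long bookkeeping proof (five fence values, four IVT roots, two windows); about twice the default budget
/-- **THE LONE-LETTER LAW FOR THREE LETTERS — derivative form, both windows.**  Let `0 < tᵢ < t₀ < tⱼ` and `a, bᵢ, bⱼ > 0` (pivot letter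
at `t₀`, one upper letter alone on each side).  Let `Tₘ ∈ (t₀, tⱼ)` be the positive root of `Qᵢ` (right window `(Tₘ, tⱼ)`) and `r₊ ∈ (tᵢ, t₀)`
the positive root of `Qⱼ` (left window `(tᵢ, r₊)`).  Then there are `T_R ∈ (Tₘ, tⱼ)` and `T_L ∈ (tᵢ, r₊)` such that the logarithmic derivative
`ℓ = (bᵢ−bⱼ)(Q₀′/Q₀ − 1/(T−t₀)) + (a+bⱼ)(Qᵢ′/Qᵢ − 1/(T−tᵢ)) − (a+bᵢ)(Qⱼ′/Qⱼ − 1/(T−tⱼ))` of the weight-free function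
`X₀^{bᵢ−bⱼ} Xᵢ^{a+bⱼ} Xⱼ^{−(a+bᵢ)}` satisfies: `ℓ > 0` on `(Tₘ, T_R)`, `ℓ(T_R) = 0`, `ℓ < 0` on `(T_R, tⱼ)`; `ℓ < 0` on `(tᵢ, T_L)`, `ℓ(T_L) = 0`,
`ℓ > 0` on `(T_L, r₊)`.  (Proof: `ℓ·Q₀QᵢQⱼ·∏(T−tₘ) = 2T·𝒩(T)` with the quintic `𝒩` of `quintic_factor`; `𝒩(r₋) > 0 > 𝒩(tᵢ)`, `𝒩(r₊) > 0 > 𝒩(Tₘ)`,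
`𝒩(tⱼ) > 0` fence four real roots `ρ₁ < tᵢ < T_L < r₊ < ρ₃ < Tₘ < T_R < tⱼ`; three of them lie outside each window, so by `fence` the window's
root is unique; the sign of the denominator is constant on each window.)  This is the exact «K = 3 lone-letter law» located by the lineage
(memo PROFILE-GAUGE.md §4–§5): no slack, all rates, all positions. [folklore] -/
theorem logDeriv_fence {a bi bj t₀ ti tj : ℝ} (ha : 0 < a) (hbi : 0 < bi) (hbj : 0 < bj) (hti : 0 < ti) (hi0 : ti < t₀)
    (h0j : t₀ < tj) :
    ∃ Tm rp TL TR : ℝ,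
      (ti < TL ∧ TL < rp ∧ rp < t₀ ∧ t₀ < Tm ∧ Tm < TR ∧ TR < tj) ∧
      (bj * (Tm + t₀) * (tj - Tm) - a * (Tm + tj) * (Tm - t₀)) = 0 ∧
      (bi * (rp + t₀) * (rp - ti) + a * (rp + ti) * (rp - t₀)) = 0 ∧
      (∀ T : ℝ, 0 < T → T < Tm → 0 < (bj * (T + t₀) * (tj - T) - a * (T + tj) * (T - t₀))) ∧
      (∀ T : ℝ, Tm < T → (bj * (T + t₀) * (tj - T) - a * (T + tj) * (T - t₀)) < 0) ∧
      (∀ T : ℝ, 0 < T → T < rp → (bi * (T + t₀) * (T - ti) + a * (T + ti) * (T - t₀)) < 0) ∧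
      (∀ T : ℝ, rp < T → 0 < (bi * (T + t₀) * (T - ti) + a * (T + ti) * (T - t₀))) ∧
      (∀ T : ℝ, Tm < T → T < TR →
        0 < ((bi - bj) * ((bj * ((T - tj) + (T + ti)) - bi * ((T - ti) + (T + tj))) / (bj * (T + ti) * (T - tj) - bi * (T + tj) * (T - ti)) - 1 / (T - t₀))
      + (a + bj) * ((bj * ((tj - T) - (T + t₀)) - a * ((T - t₀) + (T + tj))) / (bj * (T + t₀) * (tj - T) - a * (T + tj) * (T - t₀)) - 1 / (T - ti))
      - (a + bi) * ((bi * ((T - ti) + (T + t₀)) + a * ((T - t₀) + (T + ti))) / (bi * (T + t₀) * (T - ti) + a * (T + ti) * (T - t₀)) - 1 / (T - tj)))) ∧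
      ((bi - bj) * ((bj * ((TR - tj) + (TR + ti)) - bi * ((TR - ti) + (TR + tj))) / (bj * (TR + ti) * (TR - tj) - bi * (TR + tj) * (TR - ti)) - 1 / (TR - t₀))
      + (a + bj) * ((bj * ((tj - TR) - (TR + t₀)) - a * ((TR - t₀) + (TR + tj))) / (bj * (TR + t₀) * (tj - TR) - a * (TR + tj) * (TR - t₀)) - 1 / (TR - ti))
      - (a + bi) * ((bi * ((TR - ti) + (TR + t₀)) + a * ((TR - t₀) + (TR + ti))) / (bi * (TR + t₀) * (TR - ti) + a * (TR + ti) * (TR - t₀)) - 1 / (TR - tj))) = 0 ∧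
      (∀ T : ℝ, TR < T → T < tj →
        ((bi - bj) * ((bj * ((T - tj) + (T + ti)) - bi * ((T - ti) + (T + tj))) / (bj * (T + ti) * (T - tj) - bi * (T + tj) * (T - ti)) - 1 / (T - t₀))
      + (a + bj) * ((bj * ((tj - T) - (T + t₀)) - a * ((T - t₀) + (T + tj))) / (bj * (T + t₀) * (tj - T) - a * (T + tj) * (T - t₀)) - 1 / (T - ti))
      - (a + bi) * ((bi * ((T - ti) + (T + t₀)) + a * ((T - t₀) + (T + ti))) / (bi * (T + t₀) * (T - ti) + a * (T + ti) * (T - t₀)) - 1 / (T - tj))) < 0) ∧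
      (∀ T : ℝ, ti < T → T < TL →
        ((bi - bj) * ((bj * ((T - tj) + (T + ti)) - bi * ((T - ti) + (T + tj))) / (bj * (T + ti) * (T - tj) - bi * (T + tj) * (T - ti)) - 1 / (T - t₀))
      + (a + bj) * ((bj * ((tj - T) - (T + t₀)) - a * ((T - t₀) + (T + tj))) / (bj * (T + t₀) * (tj - T) - a * (T + tj) * (T - t₀)) - 1 / (T - ti))
      - (a + bi) * ((bi * ((T - ti) + (T + t₀)) + a * ((T - t₀) + (T + ti))) / (bi * (T + t₀) * (T - ti) + a * (T + ti) * (T - t₀)) - 1 / (T - tj))) < 0) ∧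
      ((bi - bj) * ((bj * ((TL - tj) + (TL + ti)) - bi * ((TL - ti) + (TL + tj))) / (bj * (TL + ti) * (TL - tj) - bi * (TL + tj) * (TL - ti)) - 1 / (TL - t₀))
      + (a + bj) * ((bj * ((tj - TL) - (TL + t₀)) - a * ((TL - t₀) + (TL + tj))) / (bj * (TL + t₀) * (tj - TL) - a * (TL + tj) * (TL - t₀)) - 1 / (TL - ti))
      - (a + bi) * ((bi * ((TL - ti) + (TL + t₀)) + a * ((TL - t₀) + (TL + ti))) / (bi * (TL + t₀) * (TL - ti) + a * (TL + ti) * (TL - t₀)) - 1 / (TL - tj))) = 0 ∧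
      (∀ T : ℝ, TL < T → T < rp →
        0 < ((bi - bj) * ((bj * ((T - tj) + (T + ti)) - bi * ((T - ti) + (T + tj))) / (bj * (T + ti) * (T - tj) - bi * (T + tj) * (T - ti)) - 1 / (T - t₀))
      + (a + bj) * ((bj * ((tj - T) - (T + t₀)) - a * ((T - t₀) + (T + tj))) / (bj * (T + t₀) * (tj - T) - a * (T + tj) * (T - t₀)) - 1 / (T - ti))
      - (a + bi) * ((bi * ((T - ti) + (T + t₀)) + a * ((T - t₀) + (T + ti))) / (bi * (T + t₀) * (T - ti) + a * (T + ti) * (T - t₀)) - 1 / (T - tj)))) := by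
  have ht₀ : 0 < t₀ := by linarith
  obtain ⟨Tm, hTm1, hTm2, hTm0, qi_pos, qi_neg, dqi_neg⟩ := rightEdge_exists ha hbj ht₀ h0j
  obtain ⟨rm, rp, hrm1, hrm2, hrp1, hrp2, hrm0, hrp0, dqj_neg, dqj_pos, qj_neg, qj_pos⟩ := leftEdge_exists ha hbi hti hi0
  obtain ⟨q0neg, q0pos, qipos, -, -, -⟩ := bracket_signs ha hbi hbj hti hi0 h0j
  obtain ⟨P, hPdeg, hPN⟩ := quintic_factor a bi bj t₀ ti tj
  obtain ⟨Nti, Ntj⟩ := quintic_sign_letters ha hbi hbj hti hi0 h0j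
  -- `N` at the three bracket roots
  have Nrp : 0 < ((bi - bj) * ((bj * ((rp - tj) + (rp + ti)) - bi * ((rp - ti) + (rp + tj))) * (bj * (rp + t₀) * (tj - rp) - a * (rp + tj) * (rp - t₀)) * (bi * (rp + t₀) * (rp - ti) + a * (rp + ti) * (rp - t₀)) * ((rp - t₀) * (rp - ti) * (rp - tj))
        - (bj * (rp + ti) * (rp - tj) - bi * (rp + tj) * (rp - ti)) * (bj * (rp + t₀) * (tj - rp) - a * (rp + tj) * (rp - t₀)) * (bi * (rp + t₀) * (rp - ti) + a * (rp + ti) * (rp - t₀)) * ((rp - ti) * (rp - tj)))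
      + (a + bj) * ((bj * ((tj - rp) - (rp + t₀)) - a * ((rp - t₀) + (rp + tj))) * (bj * (rp + ti) * (rp - tj) - bi * (rp + tj) * (rp - ti)) * (bi * (rp + t₀) * (rp - ti) + a * (rp + ti) * (rp - t₀)) * ((rp - t₀) * (rp - ti) * (rp - tj))
        - (bj * (rp + ti) * (rp - tj) - bi * (rp + tj) * (rp - ti)) * (bj * (rp + t₀) * (tj - rp) - a * (rp + tj) * (rp - t₀)) * (bi * (rp + t₀) * (rp - ti) + a * (rp + ti) * (rp - t₀)) * ((rp - t₀) * (rp - tj)))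
      - (a + bi) * ((bi * ((rp - ti) + (rp + t₀)) + a * ((rp - t₀) + (rp + ti))) * (bj * (rp + ti) * (rp - tj) - bi * (rp + tj) * (rp - ti)) * (bj * (rp + t₀) * (tj - rp) - a * (rp + tj) * (rp - t₀)) * ((rp - t₀) * (rp - ti) * (rp - tj))
        - (bj * (rp + ti) * (rp - tj) - bi * (rp + tj) * (rp - ti)) * (bj * (rp + t₀) * (tj - rp) - a * (rp + tj) * (rp - t₀)) * (bi * (rp + t₀) * (rp - ti) + a * (rp + ti) * (rp - t₀)) * ((rp - t₀) * (rp - ti)))) := by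
    rw [quintic_at_rootQj hrp0]
    have h1 : -(a + bi) * (bi * ((rp - ti) + (rp + t₀)) + a * ((rp - t₀) + (rp + ti))) < 0 := mul_neg_of_neg_of_pos (by linarith) dqj_pos
    have h2 : (bj * (rp + ti) * (rp - tj) - bi * (rp + tj) * (rp - ti)) * (bj * (rp + t₀) * (tj - rp) - a * (rp + tj) * (rp - t₀)) < 0 :=
      mul_neg_of_neg_of_pos (q0neg rp hrp1 (by linarith)) (qipos rp (by linarith) hrp2)
    have h3 : 0 < ((rp - t₀) * (rp - ti) * (rp - tj)) :=
      mul_pos_of_neg_of_neg (mul_neg_of_neg_of_pos (by linarith) (by linarith)) (by linarith)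
    exact mul_pos (mul_pos_of_neg_of_neg h1 h2) h3
  have Nrm : ((bi - bj) * ((bj * ((rm - tj) + (rm + ti)) - bi * ((rm - ti) + (rm + tj))) * (bj * (rm + t₀) * (tj - rm) - a * (rm + tj) * (rm - t₀)) * (bi * (rm + t₀) * (rm - ti) + a * (rm + ti) * (rm - t₀)) * ((rm - t₀) * (rm - ti) * (rm - tj))
        - (bj * (rm + ti) * (rm - tj) - bi * (rm + tj) * (rm - ti)) * (bj * (rm + t₀) * (tj - rm) - a * (rm + tj) * (rm - t₀)) * (bi * (rm + t₀) * (rm - ti) + a * (rm + ti) * (rm - t₀)) * ((rm - ti) * (rm - tj)))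
      + (a + bj) * ((bj * ((tj - rm) - (rm + t₀)) - a * ((rm - t₀) + (rm + tj))) * (bj * (rm + ti) * (rm - tj) - bi * (rm + tj) * (rm - ti)) * (bi * (rm + t₀) * (rm - ti) + a * (rm + ti) * (rm - t₀)) * ((rm - t₀) * (rm - ti) * (rm - tj))
        - (bj * (rm + ti) * (rm - tj) - bi * (rm + tj) * (rm - ti)) * (bj * (rm + t₀) * (tj - rm) - a * (rm + tj) * (rm - t₀)) * (bi * (rm + t₀) * (rm - ti) + a * (rm + ti) * (rm - t₀)) * ((rm - t₀) * (rm - tj)))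
      - (a + bi) * ((bi * ((rm - ti) + (rm + t₀)) + a * ((rm - t₀) + (rm + ti))) * (bj * (rm + ti) * (rm - tj) - bi * (rm + tj) * (rm - ti)) * (bj * (rm + t₀) * (tj - rm) - a * (rm + tj) * (rm - t₀)) * ((rm - t₀) * (rm - ti) * (rm - tj))
        - (bj * (rm + ti) * (rm - tj) - bi * (rm + tj) * (rm - ti)) * (bj * (rm + t₀) * (tj - rm) - a * (rm + tj) * (rm - t₀)) * (bi * (rm + t₀) * (rm - ti) + a * (rm + ti) * (rm - t₀)) * ((rm - t₀) * (rm - ti)))) < 0 := by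
    rw [quintic_at_rootQj hrm0]
    have h1 : 0 < -(a + bi) * (bi * ((rm - ti) + (rm + t₀)) + a * ((rm - t₀) + (rm + ti))) := mul_pos_of_neg_of_neg (by linarith) dqj_neg
    have h2 : 0 < (bj * (rm + ti) * (rm - tj) - bi * (rm + tj) * (rm - ti)) * (bj * (rm + t₀) * (tj - rm) - a * (rm + tj) * (rm - t₀)) :=
      mul_pos (q0pos rm (by linarith) hrm2) (qipos rm hrm1 (by linarith))
    have h3 : ((rm - t₀) * (rm - ti) * (rm - tj)) < 0 :=
      mul_neg_of_pos_of_neg (mul_pos_of_neg_of_neg (by linarith) (by linarith)) (by linarith)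
    exact mul_neg_of_pos_of_neg (mul_pos h1 h2) h3
  have NTm : ((bi - bj) * ((bj * ((Tm - tj) + (Tm + ti)) - bi * ((Tm - ti) + (Tm + tj))) * (bj * (Tm + t₀) * (tj - Tm) - a * (Tm + tj) * (Tm - t₀)) * (bi * (Tm + t₀) * (Tm - ti) + a * (Tm + ti) * (Tm - t₀)) * ((Tm - t₀) * (Tm - ti) * (Tm - tj))
        - (bj * (Tm + ti) * (Tm - tj) - bi * (Tm + tj) * (Tm - ti)) * (bj * (Tm + t₀) * (tj - Tm) - a * (Tm + tj) * (Tm - t₀)) * (bi * (Tm + t₀) * (Tm - ti) + a * (Tm + ti) * (Tm - t₀)) * ((Tm - ti) * (Tm - tj)))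
      + (a + bj) * ((bj * ((tj - Tm) - (Tm + t₀)) - a * ((Tm - t₀) + (Tm + tj))) * (bj * (Tm + ti) * (Tm - tj) - bi * (Tm + tj) * (Tm - ti)) * (bi * (Tm + t₀) * (Tm - ti) + a * (Tm + ti) * (Tm - t₀)) * ((Tm - t₀) * (Tm - ti) * (Tm - tj))
        - (bj * (Tm + ti) * (Tm - tj) - bi * (Tm + tj) * (Tm - ti)) * (bj * (Tm + t₀) * (tj - Tm) - a * (Tm + tj) * (Tm - t₀)) * (bi * (Tm + t₀) * (Tm - ti) + a * (Tm + ti) * (Tm - t₀)) * ((Tm - t₀) * (Tm - tj)))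
      - (a + bi) * ((bi * ((Tm - ti) + (Tm + t₀)) + a * ((Tm - t₀) + (Tm + ti))) * (bj * (Tm + ti) * (Tm - tj) - bi * (Tm + tj) * (Tm - ti)) * (bj * (Tm + t₀) * (tj - Tm) - a * (Tm + tj) * (Tm - t₀)) * ((Tm - t₀) * (Tm - ti) * (Tm - tj))
        - (bj * (Tm + ti) * (Tm - tj) - bi * (Tm + tj) * (Tm - ti)) * (bj * (Tm + t₀) * (tj - Tm) - a * (Tm + tj) * (Tm - t₀)) * (bi * (Tm + t₀) * (Tm - ti) + a * (Tm + ti) * (Tm - t₀)) * ((Tm - t₀) * (Tm - ti)))) < 0 := by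
    rw [quintic_at_rootQi hTm0]
    have h1 : (a + bj) * (bj * ((tj - Tm) - (Tm + t₀)) - a * ((Tm - t₀) + (Tm + tj))) < 0 := mul_neg_of_pos_of_neg (by linarith) dqi_neg
    have h2 : (bj * (Tm + ti) * (Tm - tj) - bi * (Tm + tj) * (Tm - ti)) * (bi * (Tm + t₀) * (Tm - ti) + a * (Tm + ti) * (Tm - t₀)) < 0 :=
      mul_neg_of_neg_of_pos (q0neg Tm (by linarith) hTm2) (qj_pos Tm (by linarith))
    have h3 : ((Tm - t₀) * (Tm - ti) * (Tm - tj)) < 0 :=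
      mul_neg_of_pos_of_neg (mul_pos (by linarith) (by linarith)) (by linarith)
    exact mul_neg_of_pos_of_neg (mul_pos_of_neg_of_neg h1 h2) h3
  -- the quintic's fence values
  rw [hPN ti] at Nti
  rw [hPN tj] at Ntj
  rw [hPN rp] at Nrp
  rw [hPN rm] at Nrm
  rw [hPN Tm] at NTm
  have Pti : P.eval ti < 0 := neg_of_mul_neg_right Nti (by linarith)
  have Ptj : 0 < P.eval tj := pos_of_mul_pos_right Ntj (by linarith)
  have Prp : 0 < P.eval rp := pos_of_mul_pos_right Nrp (by linarith)
  have Prm : 0 < P.eval rm := pos_of_mul_neg_right Nrm (by linarith)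
  have PTm : P.eval Tm < 0 := neg_of_mul_neg_right NTm (by linarith)
  clear Nti Ntj Nrp Nrm NTm
  -- four fenced roots
  have hPc : ∀ u v : ℝ, ContinuousOn (fun T : ℝ => P.eval T) (Set.Icc u v) := fun u v => P.continuousOn
  obtain ⟨ρ₁, ⟨-, hρ₁⟩, e₁⟩ := intermediate_value_Ioo' (by linarith : rm ≤ ti) (hPc rm ti) ⟨Pti, Prm⟩
  obtain ⟨TL, ⟨hL1, hL2⟩, eL⟩ := intermediate_value_Ioo (le_of_lt hrp1) (hPc ti rp) ⟨Pti, Prp⟩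
  obtain ⟨ρ₃, ⟨h31, h32⟩, e₃⟩ := intermediate_value_Ioo' (by linarith : rp ≤ Tm) (hPc rp Tm) ⟨PTm, Prp⟩
  obtain ⟨TR, ⟨hR1, hR2⟩, eR⟩ := intermediate_value_Ioo (le_of_lt hTm2) (hPc Tm tj) ⟨PTm, Ptj⟩
  simp only at e₁ eL e₃ eR
  have sR : P.eval Tm * P.eval tj < 0 := mul_neg_of_neg_of_pos PTm Ptj
  have sL : P.eval ti * P.eval rp < 0 := mul_neg_of_neg_of_pos Pti Prp
  -- uniqueness of the window roots (three fenced roots outside each window)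
  have uniqR : ∀ s : ℝ, Tm < s → s < tj → P.eval s = 0 → s = TR := by
    intro s hs1 hs2 hs0
    by_contra hne
    rcases lt_or_gt_of_ne hne with h | h
    · exact fence P hPdeg hTm2 e₁ eL e₃ (Or.inl (by linarith)) (Or.inl (by linarith)) (Or.inl h32)
        (ne_of_lt (by linarith)) (ne_of_lt (by linarith)) (ne_of_lt (by linarith)) sR hs1 h hR2 hs0 eR
    · exact fence P hPdeg hTm2 e₁ eL e₃ (Or.inl (by linarith)) (Or.inl (by linarith)) (Or.inl h32)
        (ne_of_lt (by linarith)) (ne_of_lt (by linarith)) (ne_of_lt (by linarith)) sR hR1 h hs2 eR hs0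
  have uniqL : ∀ s : ℝ, ti < s → s < rp → P.eval s = 0 → s = TL := by
    intro s hs1 hs2 hs0
    by_contra hne
    rcases lt_or_gt_of_ne hne with h | h
    · exact fence P hPdeg hrp1 e₁ e₃ eR (Or.inl hρ₁) (Or.inr h31) (Or.inr (by linarith))
        (ne_of_lt (by linarith)) (ne_of_lt (by linarith)) (ne_of_lt (by linarith)) sL hs1 h hL2 hs0 eL
    · exact fence P hPdeg hrp1 e₁ e₃ eR (Or.inl hρ₁) (Or.inr h31) (Or.inr (by linarith))
        (ne_of_lt (by linarith)) (ne_of_lt (by linarith)) (ne_of_lt (by linarith)) sL hL1 h hs2 eL hs0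
  -- hence one sign of the quintic on each side of the window root
  have PnegR : ∀ T : ℝ, Tm < T → T < TR → P.eval T < 0 := by
    intro T h1 h2
    rcases lt_trichotomy (P.eval T) 0 with h | h | h
    · exact h
    · exact absurd (uniqR T h1 (by linarith) h) (ne_of_lt h2)
    · exfalso
      obtain ⟨s, ⟨hs1, hs2⟩, hs0⟩ := intermediate_value_Ioo (le_of_lt h1) (hPc Tm T) ⟨PTm, h⟩
      have := uniqR s hs1 (by linarith) hs0
      linarith
  have PposR : ∀ T : ℝ, TR < T → T < tj → 0 < P.eval T := by
    intro T h1 h2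
    rcases lt_trichotomy (P.eval T) 0 with h | h | h
    · exfalso
      obtain ⟨s, ⟨hs1, hs2⟩, hs0⟩ := intermediate_value_Ioo (le_of_lt h2) (hPc T tj) ⟨h, Ptj⟩
      have := uniqR s (by linarith) hs2 hs0
      linarith
    · exact absurd (uniqR T (by linarith) h2 h) (ne_of_gt h1)
    · exact h
  have PnegL : ∀ T : ℝ, ti < T → T < TL → P.eval T < 0 := by
    intro T h1 h2
    rcases lt_trichotomy (P.eval T) 0 with h | h | h
    · exact h
    · exact absurd (uniqL T h1 (by linarith) h) (ne_of_lt h2)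
    · exfalso
      obtain ⟨s, ⟨hs1, hs2⟩, hs0⟩ := intermediate_value_Ioo (le_of_lt h1) (hPc ti T) ⟨Pti, h⟩
      have := uniqL s hs1 (by linarith) hs0
      linarith
  have PposL : ∀ T : ℝ, TL < T → T < rp → 0 < P.eval T := by
    intro T h1 h2
    rcases lt_trichotomy (P.eval T) 0 with h | h | h
    · exfalso
      obtain ⟨s, ⟨hs1, hs2⟩, hs0⟩ := intermediate_value_Ioo (le_of_lt h2) (hPc T rp) ⟨h, Prp⟩
      have := uniqL s (by linarith) hs2 hs0
      linarith
    · exact absurd (uniqL T (by linarith) h2 h) (ne_of_gt h1)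
    · exact h
  -- the denominator has one sign on each window
  have keyR : ∀ T : ℝ, Tm < T → T < tj →
      ((bi - bj) * ((bj * ((T - tj) + (T + ti)) - bi * ((T - ti) + (T + tj))) / (bj * (T + ti) * (T - tj) - bi * (T + tj) * (T - ti)) - 1 / (T - t₀))
      + (a + bj) * ((bj * ((tj - T) - (T + t₀)) - a * ((T - t₀) + (T + tj))) / (bj * (T + t₀) * (tj - T) - a * (T + tj) * (T - t₀)) - 1 / (T - ti))
      - (a + bi) * ((bi * ((T - ti) + (T + t₀)) + a * ((T - t₀) + (T + ti))) / (bi * (T + t₀) * (T - ti) + a * (T + ti) * (T - t₀)) - 1 / (T - tj)))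
        * ((bj * (T + ti) * (T - tj) - bi * (T + tj) * (T - ti)) * (bj * (T + t₀) * (tj - T) - a * (T + tj) * (T - t₀)) * (bi * (T + t₀) * (T - ti) + a * (T + ti) * (T - t₀)) * ((T - t₀) * (T - ti) * (T - tj))) = 2 * T * P.eval T ∧
      (bj * (T + ti) * (T - tj) - bi * (T + tj) * (T - ti)) * (bj * (T + t₀) * (tj - T) - a * (T + tj) * (T - t₀)) * (bi * (T + t₀) * (T - ti) + a * (T + ti) * (T - t₀)) * ((T - t₀) * (T - ti) * (T - tj)) < 0 := by
    intro T h1 h2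
    have c0 : (bj * (T + ti) * (T - tj) - bi * (T + tj) * (T - ti)) < 0 := q0neg T (by linarith) h2
    have ci : (bj * (T + t₀) * (tj - T) - a * (T + tj) * (T - t₀)) < 0 := qi_neg T h1
    have cj : 0 < (bi * (T + t₀) * (T - ti) + a * (T + ti) * (T - t₀)) := qj_pos T (by linarith)
    refine ⟨?_, ?_⟩
    · rw [← hPN T]
      exact logDeriv_mul_denominators (ne_of_lt c0) (ne_of_lt ci) (ne_of_gt cj) (ne_of_gt (by linarith))
        (ne_of_gt (by linarith)) (ne_of_lt (by linarith))
    · have hL : ((T - t₀) * (T - ti) * (T - tj)) < 0 := mul_neg_of_pos_of_neg (mul_pos (by linarith) (by linarith)) (by linarith)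
      exact mul_neg_of_pos_of_neg (mul_pos (mul_pos_of_neg_of_neg c0 ci) cj) hL
  have keyL : ∀ T : ℝ, ti < T → T < rp →
      ((bi - bj) * ((bj * ((T - tj) + (T + ti)) - bi * ((T - ti) + (T + tj))) / (bj * (T + ti) * (T - tj) - bi * (T + tj) * (T - ti)) - 1 / (T - t₀))
      + (a + bj) * ((bj * ((tj - T) - (T + t₀)) - a * ((T - t₀) + (T + tj))) / (bj * (T + t₀) * (tj - T) - a * (T + tj) * (T - t₀)) - 1 / (T - ti))
      - (a + bi) * ((bi * ((T - ti) + (T + t₀)) + a * ((T - t₀) + (T + ti))) / (bi * (T + t₀) * (T - ti) + a * (T + ti) * (T - t₀)) - 1 / (T - tj)))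
        * ((bj * (T + ti) * (T - tj) - bi * (T + tj) * (T - ti)) * (bj * (T + t₀) * (tj - T) - a * (T + tj) * (T - t₀)) * (bi * (T + t₀) * (T - ti) + a * (T + ti) * (T - t₀)) * ((T - t₀) * (T - ti) * (T - tj))) = 2 * T * P.eval T ∧
      0 < (bj * (T + ti) * (T - tj) - bi * (T + tj) * (T - ti)) * (bj * (T + t₀) * (tj - T) - a * (T + tj) * (T - t₀)) * (bi * (T + t₀) * (T - ti) + a * (T + ti) * (T - t₀)) * ((T - t₀) * (T - ti) * (T - tj)) := by
    intro T h1 h2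
    have c0 : (bj * (T + ti) * (T - tj) - bi * (T + tj) * (T - ti)) < 0 := q0neg T h1 (by linarith)
    have ci : 0 < (bj * (T + t₀) * (tj - T) - a * (T + tj) * (T - t₀)) := qipos T (by linarith) (by linarith)
    have cj : (bi * (T + t₀) * (T - ti) + a * (T + ti) * (T - t₀)) < 0 := qj_neg T (by linarith) h2
    refine ⟨?_, ?_⟩
    · rw [← hPN T]
      exact logDeriv_mul_denominators (ne_of_lt c0) (ne_of_gt ci) (ne_of_lt cj) (ne_of_lt (by linarith))
        (ne_of_gt (by linarith)) (ne_of_lt (by linarith))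
    · have hL : 0 < ((T - t₀) * (T - ti) * (T - tj)) := mul_pos_of_neg_of_neg (mul_neg_of_neg_of_pos (by linarith) (by linarith)) (by linarith)
      exact mul_pos (mul_pos_of_neg_of_neg (mul_neg_of_neg_of_pos c0 ci) cj) hL
  refine ⟨Tm, rp, TL, TR, ⟨hL1, hL2, hrp2, hTm1, hR1, hR2⟩, hTm0, hrp0, qi_pos, qi_neg, qj_neg, qj_pos,
    ?_, ?_, ?_, ?_, ?_, ?_⟩
  · intro T h1 h2
    obtain ⟨hk, hD⟩ := keyR T h1 (by linarith)
    have hP : 2 * T * P.eval T < 0 := mul_neg_of_pos_of_neg (by linarith) (PnegR T h1 h2)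
    rw [← hk] at hP
    rcases mul_neg_iff.mp hP with ⟨h, -⟩ | ⟨-, h⟩
    · exact h
    · exact absurd h (not_lt.mpr hD.le)
  · obtain ⟨hk, hD⟩ := keyR TR hR1 hR2
    rw [eR, mul_zero] at hk
    rcases mul_eq_zero.mp hk with h | h
    · exact h
    · exact absurd h (ne_of_lt hD)
  · intro T h1 h2
    obtain ⟨hk, hD⟩ := keyR T (by linarith) h2
    have hP : 0 < 2 * T * P.eval T := mul_pos (by linarith) (PposR T h1 h2)
    rw [← hk] at hP
    rcases mul_pos_iff.mp hP with ⟨-, h⟩ | ⟨h, -⟩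
    · exact absurd h (not_lt.mpr hD.le)
    · exact h
  · intro T h1 h2
    obtain ⟨hk, hD⟩ := keyL T h1 (by linarith)
    have hP : 2 * T * P.eval T < 0 := mul_neg_of_pos_of_neg (by linarith) (PnegL T h1 h2)
    rw [← hk] at hP
    rcases mul_neg_iff.mp hP with ⟨-, h⟩ | ⟨h, -⟩
    · exact absurd h (not_lt.mpr hD.le)
    · exact h
  · obtain ⟨hk, hD⟩ := keyL TL hL1 hL2
    rw [eL, mul_zero] at hk
    rcases mul_eq_zero.mp hk with h | h
    · exact h
    · exact absurd h (ne_of_gt hD)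
  · intro T h1 h2
    obtain ⟨hk, hD⟩ := keyL T (by linarith) h2
    have hP : 0 < 2 * T * P.eval T := mul_pos (by linarith) (PposL T h1 h2)
    rw [← hk] at hP
    rcases mul_pos_iff.mp hP with ⟨h, -⟩ | ⟨-, h⟩
    · exact h
    · exact absurd h (not_lt.mpr hD.le)

end Summit.ValiantsHypothesis.ValiantsHypothesis.Theorems.LacunarySymmetroidMatrixDescartes.Pivot.CriticalWindows.Three
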